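import Summits.QuantumAdvantage.AdviceFreeQNC0.BondTwistLocal
import Summits.QuantumAdvantage.AdviceFreeQNC0.RingLinFormsGlue
import Summits.QuantumAdvantage.AdviceFreeQNC0.GlobalJuntaWindow
import HarnessLib

/-!
# Cell qa-qnc0, `p = 3` — GLUE of the constant-radius rung R-lin3 ⊗ R-loc (planner qa-qnc0-p1 g20, ask P-20e;
`exp20/Sketch20x.lean` §6: "`TwistBoundX3Local` ⇒ with `RingWindowLocalLt3` the rung `RingLinFormsLocalLt3` by one call of
`LinForms.card_le_junta_add_twist`")

**`ringLinFormsLocalLt3_of : TwistBoundX3Local → RingWindowLocalLt3 → RingLinFormsLocalLt3`** — bells = per-cut tables of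
`K ≤ (log₂N)^C` linear forms of `x` mod 3 AND the radius-`r` window at the cut (arbitrary tables) win on `≤ θ_r·2^{N−1}`, `θ_r < 1`,
GIVEN the block twist bound (error term; the block lemma `blockOpR_contracts` is in the tree, the path-sum assembly
`twistBoundX3Local_of` is open) and the windowed main term `RingWindowLocalLt3` (open).

Template: `RingOddModuliForms.lean` / `RingLinFormsGlue.ringLinFormsSharp3_of` (junta/spread dichotomy, `w = c₁K + m₁`,
junta-free window by pigeonhole `exists_window_disjoint_len`).  The sign normalisation `twist_params` repairs the typed
`∃ A ρ, ρ < 1` (no `0 ≤ ρ`): from the bound at `#supp γ ∈ {0, 1}` one gets `A ≥ 0` and may take `ρ₊ = max ρ 0`.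

WHAT THIS IS NOT: both hypotheses are OPEN; crux 22907 untouched; separation NOT moved.
-/

noncomputable section

namespace Summit.QuantumAdvantage.AdviceFreeQNC0

open Finset Literature.Computability.QuantumComplexity Literature.Computability.QuantumComplexity.RingHLF
open Literature.Computability.MetaComplexity

namespace BondTwist3

open scoped Classical in
/-- Sign normalisation of the block twist parameters: WLOG `0 ≤ A` and `0 ≤ ρ < 1`. -/
theorem twist_params (hT : TwistBoundX3Local) (r : ℕ) : ∃ A ρ : ℝ, 0 ≤ A ∧ 0 ≤ ρ ∧ ρ < 1 ∧
    ∀ (N : ℕ) (t : Fin N → (Fin N → Bool) → Bool), IsLocalRule N r t → ∀ γ : Fin N → ZMod 3,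
      ‖∑ x : Fin N → Bool,
          (ZMod.stdAddChar (∑ i : Fin N, if x i then γ i else 0) : ℂ) *
            (if (OddZeros x ∧ RingHLF.Rel x (fun k => xor (tGuess x k) (t k x))) then (1 : ℂ) else 0)‖
        ≤ A * ρ ^ (univ.filter fun i : Fin N => γ i ≠ 0).card * (2 : ℝ) ^ N := by
  classical
  obtain ⟨A, ρ, hρ1, h⟩ := hT r
  -- `A ≥ 0` from `γ = 0` at `N = 1`, `A·ρ ≥ 0` from `#supp γ = 1`
  have hloc : IsLocalRule 1 r (fun _ _ => false) := fun _ _ _ _ => rfl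
  have hA : 0 ≤ A := by
    have h0 := h 1 (fun _ _ => false) hloc (fun _ => 0)
    have hc : (univ.filter fun i : Fin 1 => (fun _ => (0 : ZMod 3)) i ≠ 0).card = 0 := by simp
    rw [hc, pow_zero, mul_one] at h0
    have := (norm_nonneg _).trans h0
    linarith
  have hAρ : 0 ≤ A * ρ := by
    have h1 := h 1 (fun _ _ => false) hloc (fun _ => 1)
    have hc : (univ.filter fun i : Fin 1 => (fun _ => (1 : ZMod 3)) i ≠ 0).card = 1 := by
      rw [Finset.filter_true_of_mem fun i _ => by show (1 : ZMod 3) ≠ 0; decide]; simp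
    rw [hc, pow_one] at h1
    have := (norm_nonneg _).trans h1
    linarith
  refine ⟨A, max ρ 0, hA, le_max_right _ _, max_lt hρ1 one_pos, fun N t ht γ => (h N t ht γ).trans ?_⟩
  rcases le_or_gt 0 ρ with hρ0 | hρ0
  · rw [max_eq_left hρ0]
  · -- `ρ < 0` forces `A = 0`
    have hA0 : A = 0 := by
      by_contra hne
      have hApos : 0 < A := lt_of_le_of_ne hA (Ne.symm hne)
      nlinarith
    rw [hA0]; simp

/-- **The constant-radius rung, modulo its two inputs.** -/
theorem ringLinFormsLocalLt3_of (hT : TwistBoundX3Local) (hW : RingWindowLocalLt3) : RingLinFormsLocalLt3 := by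
  classical
  intro r
  obtain ⟨θ₀, hθ₀, L₁, hL₁⟩ := hW r
  obtain ⟨A, ρ, hA, hρ0, hρ1, hAt⟩ := twist_params hT r
  set L₀ := max L₁ 1 with hL₀
  set ε : ℝ := (1 - θ₀) / 2 with hε
  have hεpos : 0 < ε := by rw [hε]; linarith
  refine ⟨θ₀ + ε, by rw [hε]; linarith, fun C => ?_⟩
  -- `c₁` with `3ρ^{c₁} ≤ 1`, `m₁` with `Aρ^{m₁} ≤ ε/4`
  obtain ⟨c₁, hc₁⟩ : ∃ c₁ : ℕ, (3 : ℝ) * ρ ^ c₁ ≤ 1 := by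
    obtain ⟨k, hk⟩ := exists_pow_lt_of_lt_one (show 0 < 1 / (3 : ℝ) by norm_num) hρ1
    exact ⟨k, by linarith [hk, show ρ ^ k < 1/3 from hk]⟩
  obtain ⟨m₁, hm₁⟩ : ∃ m₁ : ℕ, A * ρ ^ m₁ ≤ ε / 4 := by
    obtain ⟨k, hk⟩ := exists_pow_lt_of_lt_one (show 0 < (ε / 4) / (A + 1) by positivity) hρ1
    refine ⟨k, ?_⟩
    have hA1 : 0 < A + 1 := by positivity
    have := (lt_div_iff₀ hA1).1 hk
    nlinarith [pow_nonneg hρ0 k]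
  set D := c₁ + m₁ with hD
  obtain ⟨n₀, hn₀⟩ := const_mul_logPow_le (L₀ * (D + 1)) (2 * C)
  refine ⟨max n₀ 1, fun N hN K hK lam tab hloc => ?_⟩
  have hNn₀ : n₀ ≤ N := le_trans (le_max_left _ _) hN
  have hN1 : 1 ≤ N := le_trans (le_max_right _ _) hN
  set w := c₁ * K + m₁ with hw
  obtain ⟨J, hJcard, hgen⟩ := LinForms.card_le_junta_add_twist (p := 3) lam w
  set P : (Fin K → ZMod 3) → (Fin N → Bool) → Prop := fun v x =>
    OddZeros x ∧ RingHLF.Rel x (fun k => xor (tGuess x k) (tab k v x)) with hP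
  set Bv : ℝ := A * ρ ^ w * (2 : ℝ) ^ N with hBv
  have hBv0 : 0 ≤ Bv := by positivity
  -- room for a junta-free window of length `L₀`: `L₀ · (|J| + 1) ≤ N`
  have hJN : L₀ * (J.card + 1) ≤ N := by
    set X := (Nat.log 2 N) ^ (2 * C) with hX
    have hKsq : K * K ≤ X := (Nat.mul_le_mul hK hK).trans (by rw [hX, ← pow_add, two_mul])
    have hK1 : K ≤ K * K := by
      rcases Nat.eq_zero_or_pos K with h | h
      · rw [h]
      · exact Nat.le_mul_of_pos_left K h
    have hKX : K ≤ X := hK1.trans hKsq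
    have h1 : J.card ≤ D * X := by
      have a1 : J.card ≤ K * w := hJcard.trans (Nat.mul_le_mul_left _ (Nat.sub_le _ _))
      have a2 : K * w = c₁ * (K * K) + m₁ * K := by rw [hw]; ring
      have a3 : c₁ * (K * K) + m₁ * K ≤ c₁ * X + m₁ * X :=
        add_le_add (Nat.mul_le_mul_left _ hKsq) (Nat.mul_le_mul_left _ hKX)
      have a4 : c₁ * X + m₁ * X = D * X := by rw [hD]; ring
      omega
    have h3 := hn₀ N hNn₀
    rw [← hX] at h3
    calc L₀ * (J.card + 1) ≤ L₀ * (D * X + 1) := Nat.mul_le_mul_left _ (by omega)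
      _ = L₀ * D * X + L₀ := by ring
      _ ≤ L₀ * (D + 1) * X + L₀ * (D + 1) :=
          add_le_add (Nat.mul_le_mul_right _ (Nat.mul_le_mul_left _ (by omega))) (Nat.le_mul_of_pos_right _ (by omega))
      _ ≤ N := h3
  -- the junta-free window `[L₀ j, L₀ j + L₀)`
  obtain ⟨j, hj, hjJ⟩ := TransferWalk.exists_window_disjoint_len L₀ J
  have hfit : L₀ * j + L₀ ≤ N := by
    have : L₀ * j + L₀ ≤ L₀ * (J.card + 1) := by rw [← Nat.mul_succ]; exact Nat.mul_le_mul_left _ (by omega)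
    omega
  -- hypothesis (a): junta-selected local tables on the free window
  have ha : ∀ t : Fin K → ZMod 3, ((univ.filter fun x : Fin N → Bool =>
      P (fun j => (∑ i ∈ J, if x i then lam j i else 0) + t j) x).card : ℝ) ≤ θ₀ * (2 : ℝ) ^ (N - 1) := by
    intro t
    set rule : Fin N → (Fin N → Bool) → Bool := fun k x => tab k (fun j => (∑ i ∈ J, if x i then lam j i else 0) + t j) x
      with hrule
    have hmeas : ∀ (x x' : Fin N → Bool) (k : Fin N),
        (∀ j' : Fin N, (j'.val < L₀ * j ∨ L₀ * j + L₀ ≤ j'.val) ∨ CycNear N r j' k → x j' = x' j') →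
          rule k x = rule k x' := by
      intro x x' k hxx
      have hJeq : (fun jj => (∑ i ∈ J, if x i then lam jj i else 0) + t jj) =
          (fun jj => (∑ i ∈ J, if x' i then lam jj i else 0) + t jj) := by
        funext jj
        rw [sum_congr rfl fun i hi => by rw [hxx i (Or.inl (hjJ i hi))]]
      simp only [hrule, hJeq]
      exact hloc _ x x' k fun j' hj' => hxx j' (Or.inr hj')
    have h := hL₁ N (L₀ * j) L₀ (le_max_left _ _) hfit rule hmeas
    refine le_trans (le_of_eq ?_) h
    congr 2
  -- hypothesis (b): the block twist bound
  have hb : ∀ (v : Fin K → ZMod 3) (β : Fin N → ZMod 3), w ≤ (univ.filter fun i => β i ≠ 0).card →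
      ‖∑ x : Fin N → Bool, (ZMod.stdAddChar (∑ i, if x i then β i else 0) : ℂ) * (if P v x then (1 : ℂ) else 0)‖ ≤ Bv := by
    intro v β hβ
    have h := hAt N (fun k x => tab k v x) (hloc v) β
    refine le_trans h ?_
    rw [hBv]
    gcongr _ * ?_ * _
    exact pow_le_pow_of_le_one hρ0 hρ1.le hβ
  have hmain := hgen P (θ₀ * (2 : ℝ) ^ (N - 1)) Bv hBv0 ha hb
  have hres : ∀ x : Fin N → Bool, LinForms.resVec lam x = fun j => ∑ i, if x i then lam j i else 0 := fun x => rfl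
  have hset : (univ.filter fun x : Fin N → Bool =>
      OddZeros x ∧ RingHLF.Rel x (fun k => xor (tGuess x k) (tab k (LinForms.resVec lam x) x))) =
      univ.filter fun x : Fin N → Bool => P (fun j => ∑ i, if x i then lam j i else 0) x :=
    filter_congr fun x _ => by simp only [hP, hres]
  rw [hset]
  refine le_trans hmain ?_
  -- error term `3^K · Bv ≤ (ε/2)·2^{N-1}`
  have herr : (3 : ℝ) ^ K * Bv ≤ (ε / 2) * (2 : ℝ) ^ (N - 1) := by
    have h8 : (3 : ℝ) ^ K * (ρ ^ c₁) ^ K ≤ 1 := by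
      rw [← mul_pow]; exact pow_le_one₀ (by positivity) hc₁
    have key : (3 : ℝ) ^ K * Bv = ((3 : ℝ) ^ K * (ρ ^ c₁) ^ K) * (A * ρ ^ m₁) * (2 : ℝ) ^ N := by
      rw [hBv, hw, pow_add, pow_mul]; ring
    have hN2 : (2 : ℝ) ^ N = 2 * (2 : ℝ) ^ (N - 1) := by
      rw [← pow_succ']; congr 1; omega
    rw [key, hN2]
    have hp : (0 : ℝ) ≤ 2 * (2 : ℝ) ^ (N - 1) := by positivity
    have hq : 0 ≤ A * ρ ^ m₁ := by positivity
    calc ((3 : ℝ) ^ K * (ρ ^ c₁) ^ K) * (A * ρ ^ m₁) * (2 * (2 : ℝ) ^ (N - 1))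
        ≤ (1 * (ε / 4)) * (2 * (2 : ℝ) ^ (N - 1)) :=
          mul_le_mul_of_nonneg_right (mul_le_mul h8 hm₁ hq zero_le_one) hp
      _ = (ε / 2) * 2 ^ (N - 1) := by ring
  have h3cast : ((3 : ℕ) : ℝ) = (3 : ℝ) := by norm_num
  rw [h3cast]
  have h2N : (0 : ℝ) ≤ (2 : ℝ) ^ (N - 1) := by positivity
  have hε2 : 0 ≤ ε * (2 : ℝ) ^ (N - 1) := mul_nonneg hεpos.le h2N
  linarith

end BondTwist3

end Summit.QuantumAdvantage.AdviceFreeQNC0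

end
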